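import Summits.KontsevichZagierPeriods.KontsevichZagierPeriods.Theorems.SoloInformedCurveSectorPoly

/-!
# Solids with piecewise-polynomial fibre length are in the curve sector (Theorem XVI-P, 3-D)

Solo programme `solo-KontsevichZagierPeriods-informed`, session s32. Companion to
`SoloInformedCurveSectorPoly.lean` (Theorem XVI-P: polynomially weighted bounded planar integrals
`[D, p]`, `p ∈ ℚ[x, y]`, have `Per` in `soloInformedKappaSpan`) and
`SoloInformedCurveSectorFibre.lean` (Theorem XVI-K: a volume representation `[S, 1]` is in the
sector as soon as its fibre-length representations one dimension down are).

* `soloInformed_per_mem_span_of_fibreLength_piecewisePoly` — a volume representation `[S, 1]`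
  of dimension three whose vertical fibre length `x ↦ |S_x|` is a polynomial `pᵢ ∈ ℚ[x₁, x₂]` on
  each of finitely many bounded `ℚ`-semialgebraic pieces `Dᵢ ⊆ ℝ²` (pairwise null overlaps) and
  `0` off `⋃ Dᵢ` has `Per [S, 1] ∈ soloInformedKappaSpan`.
* `soloInformed_per_mem_span_polyGraphSolid` — in particular every solid
  `{(x, y, z) | (x, y) ∈ D, φ(x, y) ≤ z ≤ ψ(x, y)}` between two polynomial graphs `φ ≤ ψ`,
  `φ, ψ ∈ ℚ[x, y]`, over a bounded `ℚ`-semialgebraic `D ⊆ ℝ²` (Theorem XVI (d) of the residency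
  paper `paper/paper.md` §6novies, polynomial-graph case — kernel).
* `soloInformed_volumeRung_three_polyGraph`, `soloInformed_volumeRung_three_piecewisePoly` —
  **Rung 3 of the volume ladder holds on these classes, granted Huber–Wüstholz**
  (`HuberWustholzCurvePeriods`): two such solids with the same volume are connected by the
  Kontsevich–Zagier moves (Theorem XV `soloInformed_equivalent_of_mem_curveSector`).

What is NOT covered (the standing obstruction, `paper/paper.md` §6novies, §8): solids whose fibre
length is a genuinely algebraic (non-polynomial) Nash function of `(x, y)`, e.g. the unit ball
(`2√(1 − x² − y²)`); for those the planar weighted integral `[D, L_S]` is not known to lie in the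
curve sector, and no unconditional or Huber–Wüstholz-conditional Rung 3 is claimed.

References: M. Kontsevich, D. Zagier, *Periods* (2001), §1.2 [KontsevichZagier2001];
A. Huber, G. Wüstholz, *Transcendence and linear relations of 1-periods*, CUP 2022, Thm. 13.3
[HuberWuestholz2022].
-/

noncomputable section

open MeasureTheory Set
open Literature.ModelTheory.ExponentialFields Literature.NumberTheory.Transcendental
open Literature.NumberTheory.Transcendental.KZ

namespace Summit.KontsevichZagierPeriods.KontsevichZagierPeriods.Theorems

/-! ## Solids with piecewise-polynomial fibre length; Rung 3 on these classes -/

/-- **Solids with piecewise-polynomial vertical fibre length are in the curve sector.** Let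
`r = [S, 1]` be a volume representation of dimension three. If the length of the vertical fibre
`S_x = {t | (x, t) ∈ S}` is a polynomial `pᵢ(x) ∈ ℚ[x₁, x₂]` on each of finitely many bounded
`ℚ`-semialgebraic pieces `Dᵢ ⊆ ℝ²` meeting pairwise in null sets, and `0` off `⋃ Dᵢ`, then
`Per r ∈ soloInformedKappaSpan` (Theorem XVI-K `soloInformed_per_mem_span_of_fibreLength` and
Theorem XVI-P). -/
theorem soloInformed_per_mem_span_of_fibreLength_piecewisePoly (r : IntegralRep 3)
    (hr1 : ∀ x ∈ r.domain, r.integrand x = 1) {ι : Type*} (s : Finset ι)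
    (D : ι → Set (Fin 2 → ℝ)) (hD : ∀ i ∈ s, IsSemialgebraic ℚ (D i))
    (hDb : ∀ i ∈ s, Bornology.IsBounded (D i))
    (hdisj : (s : Set ι).Pairwise fun i j => volume (D i ∩ D j) = 0)
    (p : ι → MvPolynomial (Fin 2) ℚ)
    (hfib : ∀ i ∈ s, ∀ x ∈ D i,
      (volume (FibreLength.fibre r.domain x)).toReal = MvPolynomial.aeval x (p i))
    (h0 : ∀ x ∉ (⋃ i ∈ s, D i), (volume (FibreLength.fibre r.domain x)).toReal = 0) :
    soloInformedPer r ∈ soloInformedKappaSpan :=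
  soloInformed_per_mem_span_of_fibreLength r hr1 fun ρ hρ =>
    soloInformed_per_mem_span_piecewisePoly s ρ D hD hDb hdisj p
      (fun i hi z hz => by rw [hρ z hz.1, hfib i hi z hz.2]) fun z hz hz' => by
      rw [hρ z hz, h0 z hz']

/-- **Solids between two polynomial graphs are in the curve sector.** For `D ⊆ ℝ²` bounded
`ℚ`-semialgebraic and `φ ≤ ψ` on `D`, `φ, ψ ∈ ℚ[x, y]`, the volume representation of
`{(x, y, z) | (x, y) ∈ D, φ(x, y) ≤ z ≤ ψ(x, y)}` has `Per` in `soloInformedKappaSpan`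
(fibre length `ψ − φ` on `D`, `0` elsewhere). This is the polynomial-graph case of Theorem XVI (d)
of the residency paper, §6novies. -/
theorem soloInformed_per_mem_span_polyGraphSolid (r : IntegralRep 3)
    (hr1 : ∀ x ∈ r.domain, r.integrand x = 1) {D : Set (Fin 2 → ℝ)} (hD : IsSemialgebraic ℚ D)
    (hDb : Bornology.IsBounded D) (φ ψ : MvPolynomial (Fin 2) ℚ)
    (hle : ∀ x ∈ D, (MvPolynomial.aeval x φ : ℝ) ≤ MvPolynomial.aeval x ψ)
    (hdom : r.domain = KZlog.band D (fun x => (MvPolynomial.aeval x φ : ℝ))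
      fun x => (MvPolynomial.aeval x ψ : ℝ)) :
    soloInformedPer r ∈ soloInformedKappaSpan := by
  refine soloInformed_per_mem_span_of_fibreLength r hr1 fun ρ hρ => ?_
  refine soloInformed_per_mem_span_poly_on ρ hD hDb (ψ - φ) (fun z hz => ?_) fun z hz hzD => ?_
  · rw [hρ z hz.1]
    have hfib : FibreLength.fibre r.domain z =
        Icc (MvPolynomial.aeval z φ : ℝ) (MvPolynomial.aeval z ψ) := by
      ext t
      simp [FibreLength.fibre, hdom, KZlog.snoc_mem_band, hz.2]
    rw [hfib, Real.volume_Icc, ENNReal.toReal_ofReal (sub_nonneg.2 (hle z hz.2)), map_sub]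
  · rw [hρ z hz]
    have hfib : FibreLength.fibre r.domain z = ∅ := by
      ext t
      simp [FibreLength.fibre, hdom, KZlog.snoc_mem_band, hzD]
    rw [hfib, measure_empty, ENNReal.toReal_zero]

/-- **RUNG 3 ON SOLIDS BETWEEN POLYNOMIAL GRAPHS (granted Huber–Wüstholz).** Two volume
representations `[S, 1]`, `[S', 1]` of dimension three, each the solid between two polynomial
graphs `φ ≤ ψ` (`φ, ψ ∈ ℚ[x, y]`) over a bounded `ℚ`-semialgebraic planar set, with
`vol S = vol S'`, are connected by the Kontsevich–Zagier moves.
[Huber–Wüstholz 2022, Thm. 13.3; Kontsevich–Zagier 2001, §1.2] -/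
theorem soloInformed_volumeRung_three_polyGraph (hHW : HuberWustholzCurvePeriods)
    {r r' : IntegralRep 3} (h1 : ∀ x ∈ r.domain, r.integrand x = 1)
    (h1' : ∀ x ∈ r'.domain, r'.integrand x = 1)
    (hr : ∃ (D : Set (Fin 2 → ℝ)) (φ ψ : MvPolynomial (Fin 2) ℚ), IsSemialgebraic ℚ D ∧
      Bornology.IsBounded D ∧ (∀ x ∈ D, (MvPolynomial.aeval x φ : ℝ) ≤ MvPolynomial.aeval x ψ) ∧
      r.domain = KZlog.band D (fun x => (MvPolynomial.aeval x φ : ℝ))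
        fun x => (MvPolynomial.aeval x ψ : ℝ))
    (hr' : ∃ (D : Set (Fin 2 → ℝ)) (φ ψ : MvPolynomial (Fin 2) ℚ), IsSemialgebraic ℚ D ∧
      Bornology.IsBounded D ∧ (∀ x ∈ D, (MvPolynomial.aeval x φ : ℝ) ≤ MvPolynomial.aeval x ψ) ∧
      r'.domain = KZlog.band D (fun x => (MvPolynomial.aeval x φ : ℝ))
        fun x => (MvPolynomial.aeval x ψ : ℝ))
    (hv : r.value = r'.value) : Equivalent r r' := by
  obtain ⟨D, φ, ψ, hD, hDb, hle, hdom⟩ := hr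
  obtain ⟨D', φ', ψ', hD', hDb', hle', hdom'⟩ := hr'
  exact soloInformed_equivalent_of_mem_curveSector hHW
    (soloInformed_per_mem_span_polyGraphSolid r h1 hD hDb φ ψ hle hdom)
    (soloInformed_per_mem_span_polyGraphSolid r' h1' hD' hDb' φ' ψ' hle' hdom') hv

/-- **RUNG 3 ON SOLIDS WITH PIECEWISE-POLYNOMIAL FIBRE LENGTH (granted Huber–Wüstholz).** Two
volume representations of dimension three whose vertical fibre lengths are piecewise polynomial
(as in `soloInformed_per_mem_span_of_fibreLength_piecewisePoly`) and whose volumes agree are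
connected by the Kontsevich–Zagier moves. [Huber–Wüstholz 2022, Thm. 13.3] -/
theorem soloInformed_volumeRung_three_piecewisePoly (hHW : HuberWustholzCurvePeriods)
    {r r' : IntegralRep 3} (h1 : ∀ x ∈ r.domain, r.integrand x = 1)
    (h1' : ∀ x ∈ r'.domain, r'.integrand x = 1)
    (hr : ∃ (k : ℕ) (D : Fin k → Set (Fin 2 → ℝ)) (p : Fin k → MvPolynomial (Fin 2) ℚ),
      (∀ i, IsSemialgebraic ℚ (D i)) ∧ (∀ i, Bornology.IsBounded (D i)) ∧
      (Pairwise fun i j => volume (D i ∩ D j) = 0) ∧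
      (∀ i, ∀ x ∈ D i, (volume (FibreLength.fibre r.domain x)).toReal = MvPolynomial.aeval x (p i)) ∧
      (∀ x ∉ (⋃ i, D i), (volume (FibreLength.fibre r.domain x)).toReal = 0))
    (hr' : ∃ (k : ℕ) (D : Fin k → Set (Fin 2 → ℝ)) (p : Fin k → MvPolynomial (Fin 2) ℚ),
      (∀ i, IsSemialgebraic ℚ (D i)) ∧ (∀ i, Bornology.IsBounded (D i)) ∧
      (Pairwise fun i j => volume (D i ∩ D j) = 0) ∧
      (∀ i, ∀ x ∈ D i, (volume (FibreLength.fibre r'.domain x)).toReal =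
        MvPolynomial.aeval x (p i)) ∧
      (∀ x ∉ (⋃ i, D i), (volume (FibreLength.fibre r'.domain x)).toReal = 0))
    (hv : r.value = r'.value) : Equivalent r r' := by
  have key : ∀ ρ : IntegralRep 3, (∀ x ∈ ρ.domain, ρ.integrand x = 1) →
      (∃ (k : ℕ) (D : Fin k → Set (Fin 2 → ℝ)) (p : Fin k → MvPolynomial (Fin 2) ℚ),
        (∀ i, IsSemialgebraic ℚ (D i)) ∧ (∀ i, Bornology.IsBounded (D i)) ∧
        (Pairwise fun i j => volume (D i ∩ D j) = 0) ∧
        (∀ i, ∀ x ∈ D i, (volume (FibreLength.fibre ρ.domain x)).toReal =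
          MvPolynomial.aeval x (p i)) ∧
        (∀ x ∉ (⋃ i, D i), (volume (FibreLength.fibre ρ.domain x)).toReal = 0)) →
      soloInformedPer ρ ∈ soloInformedKappaSpan := by
    rintro ρ hρ ⟨k, D, p, hD, hDb, hdisj, hfib, h0⟩
    refine soloInformed_per_mem_span_of_fibreLength_piecewisePoly ρ hρ Finset.univ D
      (fun i _ => hD i) (fun i _ => hDb i) (fun i _ j _ hne => hdisj hne) p
      (fun i _ x hx => hfib i x hx) fun x hx => h0 x ?_
    simpa using hx
  exact soloInformed_equivalent_of_mem_curveSector hHW (key r h1 hr) (key r' h1' hr') hv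

end Summit.KontsevichZagierPeriods.KontsevichZagierPeriods.Theorems
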